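/-
Copyright: rh-split cell (nb, neg) gen 18, 2026-08-27.  Splitting search over kernel-typed
RH-equivalences.  A splitting `A ∧ B ⟹ RH` is CONDITIONAL bookkeeping unless `A` and `B` are both
proved; nothing here bears on the truth of RH.
-/
import Summits.RiemannHypothesis.RiemannHypothesis.Theorems.Splittings.NbTruncationC
import HarnessLib

/-!
# Truncating ζ in the Nyman–Beurling distance is decided RH-free (nb/neg V43) — part D

Continuation of `NbTruncationC` (same namespace `…Splittings.NbTruncation`; the module docstring of
`NbTruncationA` states the objects, the census row and the theorem map for all parts).  Content below is the
original one-file kernel VERBATIM (lines 1014–1298 of the uncarved file).  No `sorry`, no new axioms, no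
definitions, no instances, no notation.
-/

noncomputable section

set_option linter.dupNamespace false
open Complex MeasureTheory Set Filter
open scoped Real ENNReal

namespace Summit.RiemannHypothesis.RiemannHypothesis.Theorems.Splittings.NbTruncation

open Summit.RiemannHypothesis.RiemannHypothesis.Theses.NymanBeurling
open Summit.RiemannHypothesis.RiemannHypothesis.Theorems
open Literature.NumberTheory.LFunctions
open Literature.Barriers.RiemannHypothesis
open ArithmeticFunction

/-- **Zeros of `ζ_M` right of the critical line for every `3 ≤ M ≤ 1000` (T44e)** — assembled
from the Liouville twist at `σ = 1/2` (`M ≤ 28` minus `{4, 6, 10, 16}` and the certified cases),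
the `χ(5) = +1` twist (`M = 16`), the complex torus certificates (`M = 4, 6, 10`) and the tree's
Spira / van de Lune–te Riele / Monach-range certificates (`M = 19, 22–27, 29–1000`, zeros even
beyond `σ = 1`, `exists_zero_of_certificate'`). For `M ≤ 18`, `M = 20, 21, 28` these zeros lie in
`1/2 < σ < 1` (Platt–Trudgian: none with `σ ≥ 1`). Standard axioms only.
[cite: PlattTrudgian2016, Theorem 1.1] [cite: Apostol1990, §8.13, proof of Thm. 8.20]
[cite: Spira1968, §4 p. 173] -/
theorem exists_zero_gt_half_of_le {M : ℕ} (hM : 3 ≤ M) (hM' : M ≤ 1000) :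
    ∃ ρ : ℂ, zetaPartialSum M ρ = 0 ∧ 1 / 2 < ρ.re := by
  by_cases hc : M = 19 ∨ (22 ≤ M ∧ M ≤ 27) ∨ (29 ≤ M ∧ M ≤ 1000)
  · exact exists_zero_gt_half_of_cert hc
  by_cases h16 : M = 16
  · subst h16
    exact exists_zero_gt_half_of_realTwist_neg (by norm_num) fiveTwist_mul abs_fiveTwist_prime
      fiveTwist_sixteen_half_neg
  by_cases h4 : M = 4
  · subst h4; exact exists_zero_gt_half_four
  by_cases h6 : M = 6
  · subst h6; exact exists_zero_gt_half_six
  by_cases h10 : M = 10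
  · subst h10; exact exists_zero_gt_half_ten
  · refine exists_zero_gt_half_of_realTwist_neg (by omega) liouville_real_mul
      abs_liouville_real_prime (liouvilleTwist_half_neg ?_)
    simp only [Finset.mem_insert, Finset.mem_singleton]
    omega

/-- **Zeros of `ζ_M` right of the critical line for EVERY `M ≥ 3`**: `exists_zero_gt_half_of_le`
up to `1000`, and beyond it the catalogued barrier `TuranPartialSums` (`TuranPartialSums_holds`,
zeros even with `σ > 1`; its proof in the tree runs `native_decide` certificates, which therefore
enter the axiom closure of this declaration and of `truncFin_iff` — the `M ≤ 1000` statements are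
free of them). [cite: PlattTrudgian2016, Theorem 1.1] -/
theorem exists_zero_gt_half {M : ℕ} (hM : 3 ≤ M) :
    ∃ ρ : ℂ, zetaPartialSum M ρ = 0 ∧ 1 / 2 < ρ.re := by
  by_cases h : M ≤ 1000
  · exact exists_zero_gt_half_of_le hM h
  · exact exists_zero_gt_half_of_ge (by omega)

/-! ## §4 — The small sections: `FIN_0` false, `FIN_1` and `FIN_2` TRUE -/

/-- `t ↦ 1/(1/4+t²)` is integrable (`≤ 4 (1+t²)⁻¹`). [folklore]
(file-internal copy; the landed twin is
`Literature.NumberTheory.LFunctions.integrable_inv_quarter_add_sq`). -/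
private theorem integrable_inv_quarter_add_sq : Integrable fun t : ℝ ↦ 1 / (1 / 4 + t ^ 2) := by
  refine (integrable_inv_one_add_sq.const_mul 4).mono' ?_ (Eventually.of_forall fun t ↦ ?_)
  · exact (continuous_const.div (by fun_prop) fun t ↦
      (by positivity : (1 / 4 : ℝ) + t ^ 2 ≠ 0)).aestronglyMeasurable
  · have h1 : (0 : ℝ) < 1 / 4 + t ^ 2 := by positivity
    have h2 : (0 : ℝ) < 1 + t ^ 2 := by positivity
    rw [Real.norm_eq_abs, abs_of_pos (by positivity), div_le_iff₀ h1, ← div_eq_mul_inv,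
      div_mul_eq_mul_div, le_div_iff₀ h2]
    nlinarith [sq_nonneg t]

/-- `∫⁻ dt/(1/4+t²) = 2π` (the tree's `integral_inv_quarter_add_sq`, as a lower integral).
[folklore] -/
theorem lintegral_inv_quarter_add_sq :
    ∫⁻ t : ℝ, ENNReal.ofReal (1 / (1 / 4 + t ^ 2)) = ENNReal.ofReal (2 * π) := by
  rw [← integral_inv_quarter_add_sq, ofReal_integral_eq_lintegral_ofReal
    integrable_inv_quarter_add_sq (Eventually.of_forall fun t ↦ by positivity)]

/-- **`M = 0`: every truncated distance equals `2π`** (`ζ_0 = 0`, the integrand is `1/(1/4+t²)`),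
so `FIN_0` is false. [folklore] -/
theorem truncIntegral_zero_eq (N : ℕ) (a : Fin N → ℂ) :
    ∫⁻ t : ℝ, ENNReal.ofReal (‖1 - zetaPartialSum 0 (1 / 2 + t * Complex.I) *
        ∑ n : Fin N, a n * ((n : ℂ) + 1) ^ (-(1 / 2 + t * Complex.I))‖ ^ 2 / (1 / 4 + t ^ 2)) =
      ENNReal.ofReal (2 * π) := by
  simp only [zetaPartialSum_zero, zero_mul, sub_zero, norm_one, one_pow]
  exact lintegral_inv_quarter_add_sq

/-- `FIN_0` is FALSE (take `ε = 2π`). [folklore] -/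
theorem not_truncFin_zero :
    ¬ (∀ ε : ℝ, 0 < ε → ∃ (N : ℕ) (a : Fin N → ℂ),
      ∫⁻ t : ℝ, ENNReal.ofReal (‖1 - zetaPartialSum 0 (1 / 2 + t * Complex.I) *
        ∑ n : Fin N, a n * ((n : ℂ) + 1) ^ (-(1 / 2 + t * Complex.I))‖ ^ 2 / (1 / 4 + t ^ 2)) <
        ENNReal.ofReal ε) := by
  intro h
  obtain ⟨N, a, ha⟩ := h (2 * π) (by positivity)
  rw [truncIntegral_zero_eq] at ha
  exact lt_irrefl _ ha

/-- `ζ_1 = 1`. [folklore] -/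
theorem zetaPartialSum_one (s : ℂ) : zetaPartialSum 1 s = 1 := by
  rw [show (1 : ℕ) = 0 + 1 from rfl, zetaPartialSum_succ, zetaPartialSum_zero]
  simp

/-- `ζ_2(s) = 1 + 2^{-s}`. [folklore] -/
theorem zetaPartialSum_two (s : ℂ) : zetaPartialSum 2 s = 1 + (2 : ℂ) ^ (-s) := by
  rw [show (2 : ℕ) = 1 + 1 from rfl, zetaPartialSum_succ, zetaPartialSum_one]
  norm_num

/-- **`FIN_1` is TRUE (T44c)**: with `A = 1` (`N = 1`, `a_0 = 1`) the integrand `|1 - ζ_1 A|²`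
vanishes identically. [folklore] -/
theorem truncFin_one :
    ∀ ε : ℝ, 0 < ε → ∃ (N : ℕ) (a : Fin N → ℂ),
      ∫⁻ t : ℝ, ENNReal.ofReal (‖1 - zetaPartialSum 1 (1 / 2 + t * Complex.I) *
        ∑ n : Fin N, a n * ((n : ℂ) + 1) ^ (-(1 / 2 + t * Complex.I))‖ ^ 2 / (1 / 4 + t ^ 2)) <
        ENNReal.ofReal ε := by
  intro ε hε
  refine ⟨1, fun _ ↦ 1, ?_⟩
  have h : ∀ t : ℝ, ENNReal.ofReal (‖1 - zetaPartialSum 1 (1 / 2 + t * Complex.I) *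
      ∑ n : Fin 1, (fun _ ↦ (1 : ℂ)) n * ((n : ℂ) + 1) ^ (-(1 / 2 + t * Complex.I))‖ ^ 2 /
        (1 / 4 + t ^ 2)) = 0 := by
    intro t
    simp [zetaPartialSum_one]
  rw [lintegral_congr h, lintegral_zero]
  exact ENNReal.ofReal_pos.mpr hε

/-- `((2^j : ℕ))^{-s} = (2^{-s})^j`. [folklore] -/
theorem natCast_two_pow_cpow (j : ℕ) (w : ℂ) : ((2 ^ j : ℕ) : ℂ) ^ w = ((2 : ℂ) ^ w) ^ j := by
  have h := natCast_cpow_natCast_mul 2 j w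
  push_cast at h ⊢
  rw [← h, cpow_nat_mul]

/-- **The geometric mollifier of `ζ_2`.** The Dirichlet polynomial of length `2^K` with
`a_{2^j - 1} = (-1)^j` (`j < K`) and all other coefficients `0` is `A_K(s) = Σ_{j<K} (-2^{-s})^j`.
[folklore] -/
theorem geomPoly_eval (K : ℕ) (s : ℂ) :
    ∑ n : Fin (2 ^ K), (∑ j ∈ Finset.range K, if (n : ℕ) + 1 = 2 ^ j then (-1 : ℂ) ^ j else 0) *
        ((n : ℂ) + 1) ^ (-s) = ∑ j ∈ Finset.range K, (-(2 : ℂ) ^ (-s)) ^ j := by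
  simp_rw [Finset.sum_mul]
  rw [Finset.sum_comm]
  refine Finset.sum_congr rfl fun j hj ↦ ?_
  rw [Finset.mem_range] at hj
  have hjK : 2 ^ j - 1 < 2 ^ K :=
    lt_of_le_of_lt (Nat.sub_le _ _) (Nat.pow_lt_pow_right (by norm_num) hj)
  have h1 : 2 ^ j - 1 + 1 = 2 ^ j := Nat.sub_add_cancel Nat.one_le_two_pow
  rw [Finset.sum_eq_single ⟨2 ^ j - 1, hjK⟩]
  · simp only [h1, if_true]
    have h2 : (((2 ^ j - 1 : ℕ) : ℂ) + 1) = ((2 ^ j : ℕ) : ℂ) := by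
      exact_mod_cast congrArg (Nat.cast : ℕ → ℂ) h1
    rw [h2, natCast_two_pow_cpow]
    exact (neg_pow _ _).symm
  · intro n _ hn
    have : ¬ ((n : ℕ) + 1 = 2 ^ j) := by
      intro h
      apply hn
      ext
      change (n : ℕ) = 2 ^ j - 1
      omega
    rw [if_neg this, zero_mul]
  · intro h
    exact absurd (Finset.mem_univ _) h

/-- On the critical line `|(-2^{-s})^K|² = 2^{-K}`. [folklore] -/
theorem norm_neg_two_cpow_pow_sq (K : ℕ) (t : ℝ) :
    ‖(-(2 : ℂ) ^ (-(1 / 2 + t * I))) ^ K‖ ^ 2 = (1 / 2 : ℝ) ^ K := by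
  rw [norm_pow, norm_neg, norm_two_cpow_neg, ← pow_mul, mul_comm K 2, pow_mul]
  congr 1
  have hre : (1 / 2 + t * I : ℂ).re = 1 / 2 := by simp
  rw [hre, sq, ← Real.rpow_add (by norm_num : (0 : ℝ) < 2),
    show (-(1 / 2 : ℝ) + -(1 / 2)) = -1 by norm_num, Real.rpow_neg_one]
  norm_num

/-- **`FIN_2` is TRUE (T44d)**: `ζ_2(s) A_K(s) = 1 - (-2^{-s})^K`, so
`∫ |1 - ζ_2 A_K|² dt/(1/4+t²) = 2π · 2^{-K} → 0`. The section `ζ_2 = 1 + 2^{-s}` has its zeros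
on `σ = 0` and is boundedly invertible on the critical line; its inverse `Σ (-1)^j 2^{-js}` is
approximated by its own truncations. [folklore] -/
theorem truncFin_two :
    ∀ ε : ℝ, 0 < ε → ∃ (N : ℕ) (a : Fin N → ℂ),
      ∫⁻ t : ℝ, ENNReal.ofReal (‖1 - zetaPartialSum 2 (1 / 2 + t * Complex.I) *
        ∑ n : Fin N, a n * ((n : ℂ) + 1) ^ (-(1 / 2 + t * Complex.I))‖ ^ 2 / (1 / 4 + t ^ 2)) <
        ENNReal.ofReal ε := by
  intro ε hε
  obtain ⟨K, hK⟩ := exists_pow_lt_of_lt_one (show 0 < ε / (2 * π) by positivity)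
    (show (1 / 2 : ℝ) < 1 by norm_num)
  refine ⟨2 ^ K, fun n ↦ ∑ j ∈ Finset.range K, if (n : ℕ) + 1 = 2 ^ j then (-1 : ℂ) ^ j else 0,
    ?_⟩
  have hpt : ∀ t : ℝ, ENNReal.ofReal (‖1 - zetaPartialSum 2 (1 / 2 + t * Complex.I) *
      ∑ n : Fin (2 ^ K), (fun n : Fin (2 ^ K) ↦ ∑ j ∈ Finset.range K,
        if (n : ℕ) + 1 = 2 ^ j then (-1 : ℂ) ^ j else 0) n *
        ((n : ℂ) + 1) ^ (-(1 / 2 + t * Complex.I))‖ ^ 2 / (1 / 4 + t ^ 2)) =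
      ENNReal.ofReal ((1 / 2 : ℝ) ^ K) * ENNReal.ofReal (1 / (1 / 4 + t ^ 2)) := by
    intro t
    rw [geomPoly_eval, zetaPartialSum_two,
      show (1 : ℂ) + (2 : ℂ) ^ (-(1 / 2 + t * I)) = 1 - (-(2 : ℂ) ^ (-(1 / 2 + t * I))) by ring,
      mul_neg_geom_sum, sub_sub_cancel, norm_neg_two_cpow_pow_sq, ← ENNReal.ofReal_mul
      (by positivity)]
    congr 1
    field_simp
  rw [lintegral_congr hpt, lintegral_const_mul' _ _ ENNReal.ofReal_ne_top,
    lintegral_inv_quarter_add_sq, ← ENNReal.ofReal_mul (by positivity),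
    ENNReal.ofReal_lt_ofReal_iff hε]
  rwa [lt_div_iff₀ (by positivity)] at hK

/-! ## §5 — The census row V43: polarisation of the truncation axis -/

/-- **`FIN_M ⟺ M ∈ {1, 2}` for `M ≤ 1000` — standard axioms only** (no `native_decide`
certificate in the closure). [folklore] -/
theorem truncFin_iff_of_le_thousand {M : ℕ} (hM : M ≤ 1000) :
    (∀ ε : ℝ, 0 < ε → ∃ (N : ℕ) (a : Fin N → ℂ),
      ∫⁻ t : ℝ, ENNReal.ofReal (‖1 - zetaPartialSum M (1 / 2 + t * Complex.I) *
        ∑ n : Fin N, a n * ((n : ℂ) + 1) ^ (-(1 / 2 + t * Complex.I))‖ ^ 2 / (1 / 4 + t ^ 2)) <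
        ENNReal.ofReal ε) ↔ (M = 1 ∨ M = 2) := by
  constructor
  · intro h
    by_contra hne
    push Not at hne
    rcases Nat.lt_or_ge M 3 with hlt | hge
    · have hM0 : M = 0 := by omega
      subst hM0
      exact not_truncFin_zero h
    · obtain ⟨ρ, hζ, hρ⟩ := exists_zero_gt_half_of_le hge hM
      exact not_truncFin_of_zero hζ hρ h
  · rintro (rfl | rfl)
    · exact truncFin_one
    · exact truncFin_two

/-- **`FIN_M ⟺ M ∈ {1, 2}` for EVERY `M` (T44, the census row V43), decided RH-free**: the
truncated Nyman–Beurling statement holds exactly for the two sections `ζ_1 = 1`, `ζ_2 = 1 + 2^{-s}`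
without zeros in `σ > 0`, and fails for `M = 0` (`ζ_0 = 0`) and for every `M ≥ 3` (a zero of `ζ_M`
with `σ > 1/2` puts a positive floor under all the distances). [folklore] -/
theorem truncFin_iff (M : ℕ) :
    (∀ ε : ℝ, 0 < ε → ∃ (N : ℕ) (a : Fin N → ℂ),
      ∫⁻ t : ℝ, ENNReal.ofReal (‖1 - zetaPartialSum M (1 / 2 + t * Complex.I) *
        ∑ n : Fin N, a n * ((n : ℂ) + 1) ^ (-(1 / 2 + t * Complex.I))‖ ^ 2 / (1 / 4 + t ^ 2)) <
        ENNReal.ofReal ε) ↔ (M = 1 ∨ M = 2) := by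
  constructor
  · intro h
    by_contra hM
    push Not at hM
    rcases Nat.lt_or_ge M 3 with hlt | hge
    · have hM0 : M = 0 := by omega
      subst hM0
      exact not_truncFin_zero h
    · obtain ⟨ρ, hζ, hρ⟩ := exists_zero_gt_half hge
      exact not_truncFin_of_zero hζ hρ h
  · rintro (rfl | rfl)
    · exact truncFin_one
    · exact truncFin_two

/-- **V43, REFUTED side: «`FIN_M ∧ B ⟹ RH`» is VACUOUSLY TRUE for every `B`** whenever `M ≥ 3`:
a refuted first conjunct — bookkeeping, never a splitting. [folklore] -/
theorem truncSplit_vacuous {M : ℕ} (hM : 3 ≤ M) (B : Prop) :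
    ((∀ ε : ℝ, 0 < ε → ∃ (N : ℕ) (a : Fin N → ℂ),
      ∫⁻ t : ℝ, ENNReal.ofReal (‖1 - zetaPartialSum M (1 / 2 + t * Complex.I) *
        ∑ n : Fin N, a n * ((n : ℂ) + 1) ^ (-(1 / 2 + t * Complex.I))‖ ^ 2 / (1 / 4 + t ^ 2)) <
        ENNReal.ofReal ε) ∧ B) → _root_.RiemannHypothesis := by
  rintro ⟨h, -⟩
  obtain ⟨ρ, hζ, hρ⟩ := exists_zero_gt_half hM
  exact absurd h (not_truncFin_of_zero hζ hρ)

/-- **V43, THEOREM side: «`FIN_2 ∧ B ⟹ RH` ⟺ `B ⟹ RH`»** — a proved first conjunct is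
DECORATION: the partner `B` must carry RH alone. (Same for `FIN_1`.) [folklore] -/
theorem truncSplit_two_iff (B : Prop) :
    (((∀ ε : ℝ, 0 < ε → ∃ (N : ℕ) (a : Fin N → ℂ),
      ∫⁻ t : ℝ, ENNReal.ofReal (‖1 - zetaPartialSum 2 (1 / 2 + t * Complex.I) *
        ∑ n : Fin N, a n * ((n : ℂ) + 1) ^ (-(1 / 2 + t * Complex.I))‖ ^ 2 / (1 / 4 + t ^ 2)) <
        ENNReal.ofReal ε) ∧ B) → _root_.RiemannHypothesis) ↔ (B → _root_.RiemannHypothesis) :=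
  ⟨fun h hB ↦ h ⟨truncFin_two, hB⟩, fun h hFB ↦ h hFB.2⟩

/-- Same for `FIN_1`. [folklore] -/
theorem truncSplit_one_iff (B : Prop) :
    (((∀ ε : ℝ, 0 < ε → ∃ (N : ℕ) (a : Fin N → ℂ),
      ∫⁻ t : ℝ, ENNReal.ofReal (‖1 - zetaPartialSum 1 (1 / 2 + t * Complex.I) *
        ∑ n : Fin N, a n * ((n : ℂ) + 1) ^ (-(1 / 2 + t * Complex.I))‖ ^ 2 / (1 / 4 + t ^ 2)) <
        ENNReal.ofReal ε) ∧ B) → _root_.RiemannHypothesis) ↔ (B → _root_.RiemannHypothesis) :=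
  ⟨fun h hB ↦ h ⟨truncFin_one, hB⟩, fun h hFB ↦ h hFB.2⟩

/-- **The bridge form «`FIN_2 ⟹ E_NB`» is RH itself**: since `FIN_2` is a theorem and
`E_NB = NbThesis ⟺ RH` (`nbThesis_iff_riemannHypothesis`), the implication from the truncated
statement to the full one carries exactly RH — truncation transfers nothing. [folklore] -/
theorem truncFin_two_imp_nbThesis_iff :
    ((∀ ε : ℝ, 0 < ε → ∃ (N : ℕ) (a : Fin N → ℂ),
      ∫⁻ t : ℝ, ENNReal.ofReal (‖1 - zetaPartialSum 2 (1 / 2 + t * Complex.I) *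
        ∑ n : Fin N, a n * ((n : ℂ) + 1) ^ (-(1 / 2 + t * Complex.I))‖ ^ 2 / (1 / 4 + t ^ 2)) <
        ENNReal.ofReal ε) → NbThesis) ↔ _root_.RiemannHypothesis :=
  ⟨fun h ↦ nbThesis_iff_riemannHypothesis.mp (h truncFin_two),
    fun h _ ↦ nbThesis_iff_riemannHypothesis.mpr h⟩

/-- **… while «`E_NB ⟹ FIN_M`» is `¬RH` for `M ≥ 3`**: the full statement cannot imply a
refuted truncation unless it is itself false. [folklore] -/
theorem nbThesis_imp_truncFin_iff {M : ℕ} (hM : 3 ≤ M) :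
    (NbThesis → (∀ ε : ℝ, 0 < ε → ∃ (N : ℕ) (a : Fin N → ℂ),
      ∫⁻ t : ℝ, ENNReal.ofReal (‖1 - zetaPartialSum M (1 / 2 + t * Complex.I) *
        ∑ n : Fin N, a n * ((n : ℂ) + 1) ^ (-(1 / 2 + t * Complex.I))‖ ^ 2 / (1 / 4 + t ^ 2)) <
        ENNReal.ofReal ε)) ↔ ¬ _root_.RiemannHypothesis := by
  obtain ⟨ρ, hζ, hρ⟩ := exists_zero_gt_half hM
  have hF := not_truncFin_of_zero hζ hρ
  constructor
  · intro h hRH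
    exact hF (h (nbThesis_iff_riemannHypothesis.mpr hRH))
  · intro h hX
    exact absurd (nbThesis_iff_riemannHypothesis.mp hX) h

end Summit.RiemannHypothesis.RiemannHypothesis.Theorems.Splittings.NbTruncation

end
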